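import Mathlib
import Literature.NumberTheory.Irrationality.DirichletLValues.ChowlaMilnorConjugatesProofs
import HarnessLib

/-!
# `L(k, χ) ∉ ℚ·π^k` for even `k` and a non-trivial even quadratic character: Gun–Murty–Rath's Corollary 2

Topic `Literature/NumberTheory/Irrationality/DirichletLValues`. Sixth proofs-only file on the UNCONDITIONAL part of
S. Gun, M. R. Murty, P. Rath, *On a conjecture of Chowla and Milnor*, Canad. J. Math. **63** (2011) 1328–1344
[GunRammurtyRath2011], after `ChowlaMilnorConjugatesProofs.lean` (Proposition 2). Read on the page (p. 1336):

* **Corollary 2.** "Let `k > 1` be an even integer and `χ` be a non-trivial even quadratic character modulo `q`. Then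
  `L(k, χ)/π^k ∈ ℚ(ζ_q) ∖ ℚ`." Proof: "`L(k, χ) = [q^{−k}] Σ_{a=1}^{q} χ(a) ζ(k, a/q)
  = [q^{−k}] Σ_{a=1}^{q/2} χ(a)[ζ(k, a/q) + ζ(k, 1 − a/q)] = (2πi)^k [q^{−k}] Σ_{a=1}^{q/2} χ(a) Z_k(a, q)`. Hence the
  assertion" (by Proposition 2: the `χ(a) = ±1` are rational and not all equal for `χ ≠ 1`). "We note that for `k`
  even, `π^{−k} L(k, χ)` is rational when `χ` is the trivial character."

## What is proved (theorems only; no definition is introduced)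

* `sum_char_mul_hurwitz_symm_eq_two_mul_sum_halfSystem` — for an even character `χ` and even `k`,
  `Σ_{r ∈ ℤ/q} χ(r)(ζ(k, r/q) + ζ(k, −r/q)) = 2 Σ_{1 ≤ a < q/2, (a,q)=1} χ(a)(ζ(k, a/q) + ζ(k, −a/q))`
  (non-units contribute `0`; the units pair off as `a ↔ q − a`);
* **`LFunction_ne_ratCast_mul_pi_pow`** — COROLLARY 2, the clause "`∉ ℚ`": for `k ≥ 2` even and a non-trivial even
  quadratic Dirichlet character `χ` mod `q` (Mathlib's `DirichletCharacter`, `DirichletCharacter.Even`,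
  `MulChar.IsQuadratic`, `DirichletCharacter.LFunction`), `L(k, χ) ≠ ρ·π^k` for every rational `ρ`. (The clause
  "`∈ ℚ(ζ_q)·π^k`" is the even-space statement `ChowlaMilnorEvenProofs.span_hurwitzEven_subset_cyclotomic` summed
  against `χ`; it is not restated here.)

HONEST FRAMING (cells pub-zeta5 / zeta5-irr): kernel theorems of a PRINTED, UNCONDITIONAL statement; net named-fact
debt 0; the Chowla–Milnor conjecture stays OPEN and untyped; nothing here concerns `ζ(5)`.
-/

noncomputable section

open Finset Complex HurwitzZeta

open scoped Nat

namespace Literature.NumberTheory.Irrationality.DirichletLValues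

open Literature.NumberTheory.Transcendental

/-! ### From `ℤ/q` to the half-system -/

/-- `Σ_{r ∈ ℤ/q} F(r) = Σ_{a < q} F(a)` (`q ≠ 0`; the residues are the casts of `0, …, q − 1`). [folklore] -/
private theorem sum_univ_zmod_eq_sum_range {q : ℕ} [NeZero q] {M : Type*} [AddCommMonoid M] (F : ZMod q → M) :
    ∑ r : ZMod q, F r = ∑ a ∈ Finset.range q, F ((a : ℕ) : ZMod q) := by
  obtain ⟨m, rfl⟩ : ∃ m, q = m + 1 := ⟨q - 1, by have := NeZero.ne q; omega⟩
  have h : ∑ r : ZMod (m + 1), F r = ∑ r : ZMod (m + 1), F ((r.val : ℕ) : ZMod (m + 1)) :=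
    Finset.sum_congr rfl fun r _ => by rw [ZMod.natCast_zmod_val]
  rw [h]
  exact Fin.sum_univ_eq_sum_range (fun a : ℕ => F ((a : ℕ) : ZMod (m + 1))) (m + 1)

/-- The coprime residues below `q`, as a subset of `(0, q]` or of `[0, q)` (`q ≥ 2`). [folklore] -/
private theorem filter_coprime_Ioc_eq_range {q : ℕ} (hq : 2 ≤ q) :
    (Finset.Ioc 0 q).filter (fun a => a.Coprime q) = (Finset.range q).filter (fun a => a.Coprime q) := by
  ext a
  simp only [Finset.mem_filter, Finset.mem_Ioc, Finset.mem_range]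
  constructor
  · rintro ⟨⟨ha0, haq⟩, hcop⟩
    refine ⟨lt_of_le_of_ne haq ?_, hcop⟩
    rintro rfl
    rw [Nat.coprime_self] at hcop
    omega
  · rintro ⟨haq, hcop⟩
    refine ⟨⟨Nat.pos_of_ne_zero ?_, haq.le⟩, hcop⟩
    rintro rfl
    rw [Nat.coprime_zero_left] at hcop
    omega

/-- **From `ℤ/q` to the half-system**: for an EVEN Dirichlet character `χ` mod `q ≥ 3` and even `k`,
`Σ_{r ∈ ℤ/q} χ(r)(ζ(k, r/q) + (−1)^k ζ(k, −r/q)) = 2 Σ_{1 ≤ a < q/2, (a,q)=1} χ(a)(ζ(k, a/q) + (−1)^k ζ(k, −a/q))`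
(non-units contribute `0`; `a` and `q − a ≡ −a` contribute equally) — the step
"`Σ_{a=1}^{q} χ(a)ζ(k,a/q) = Σ_{a=1}^{q/2} χ(a)[ζ(k,a/q) + ζ(k,1−a/q)]`" of the printed proof.
[cite: GunRammurtyRath2011, proof of Corollary 2 (p. 1336)] -/
theorem sum_char_mul_hurwitz_symm_eq_two_mul_sum_halfSystem {q : ℕ} [NeZero q] (hq : 3 ≤ q)
    (χ : DirichletCharacter ℂ q) (hχ : χ.Even) {k : ℕ} (hk : Even k) :
    ∑ r : ZMod q, χ r * (hurwitzZeta (ZMod.toAddCircle r) k +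
        (-1 : ℂ) ^ k * hurwitzZeta (ZMod.toAddCircle (-r)) k) =
      2 * ∑ a ∈ (Finset.range q).filter (fun a => 2 * a < q ∧ a.Coprime q), χ ((a : ℕ) : ZMod q) *
        (hurwitzZeta (ZMod.toAddCircle ((a : ℕ) : ZMod q)) k +
          (-1 : ℂ) ^ k * hurwitzZeta (ZMod.toAddCircle (-((a : ℕ) : ZMod q))) k) := by
  set W : ZMod q → ℂ := fun r => χ r * (hurwitzZeta (ZMod.toAddCircle r) k +
    (-1 : ℂ) ^ k * hurwitzZeta (ZMod.toAddCircle (-r)) k) with hW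
  -- `W(−r) = W(r)` (`χ` even, `k` even)
  have hsymm : ∀ r : ZMod q, W (-r) = W r := by
    intro r
    simp only [hW, neg_neg, Even.neg_one_pow hk, one_mul]
    have : χ (-r) = χ r := by
      rw [show -r = (-1) * r by ring, map_mul, hχ, one_mul]
    rw [this, add_comm]
  -- non-units contribute nothing
  have hzero : ∀ a ∈ Finset.range q, W ((a : ℕ) : ZMod q) ≠ 0 → a.Coprime q := by
    intro a _ hne
    by_contra hcop
    apply hne
    simp only [hW]
    rw [MulChar.map_nonunit χ (mt (ZMod.isUnit_iff_coprime a q).mp hcop), zero_mul]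
  change ∑ r : ZMod q, W r = 2 * ∑ a ∈ (Finset.range q).filter (fun a => 2 * a < q ∧ a.Coprime q), W a
  rw [sum_univ_zmod_eq_sum_range, ← Finset.sum_filter_of_ne hzero, ← filter_coprime_Ioc_eq_range (by omega),
    sum_coprime_eq_sum_halfSystem hq (fun a : ℕ => W ((a : ℕ) : ZMod q)), Finset.mul_sum]
  refine Finset.sum_congr rfl fun a ha => ?_
  simp only [Finset.mem_filter, Finset.mem_range] at ha
  have hcast : (((q - a : ℕ)) : ZMod q) = -((a : ℕ) : ZMod q) := by
    rw [Nat.cast_sub ha.1.le, ZMod.natCast_self, zero_sub]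
  rw [hcast, hsymm, two_mul]

/-! ### Corollary 2 -/

/-- A non-trivial Dirichlet character has modulus `q ≥ 3` (for `q ≤ 2` the unit group of `ℤ/q` is trivial).
[folklore] -/
private theorem three_le_of_ne_one {q : ℕ} [NeZero q] (χ : DirichletCharacter ℂ q) (hχ : χ ≠ 1) : 3 ≤ q := by
  by_contra hq
  apply hχ
  have hφ : Nat.totient q = 1 := by
    have hq1 : 1 ≤ q := Nat.one_le_iff_ne_zero.2 (NeZero.ne q)
    interval_cases q
    · exact Nat.totient_one
    · exact Nat.totient_two
  haveI : Subsingleton (ZMod q)ˣ := by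
    rw [← Fintype.card_le_one_iff_subsingleton, ZMod.card_units_eq_totient, hφ]
  exact MulChar.ext fun u => by rw [Subsingleton.elim u 1, Units.val_one, map_one, map_one]

/-- **Gun–Murty–Rath 2011, Corollary 2 (the clause `∉ ℚ`).** "Let `k > 1` be an even integer and `χ` be a
non-trivial even quadratic character modulo `q`. Then `L(k, χ)/π^k ∈ ℚ(ζ_q) ∖ ℚ`": here, for Mathlib's `L(k, χ) =
DirichletCharacter.LFunction χ k`, the value `L(k, χ)` is NOT a rational multiple of `π^k`. Proof as printed:
`2 q^k L(k, χ) = Σ_r χ(r)(ζ(k,r/q) + ζ(k,−r/q)) = 2 Σ_{half-system} χ(a)(ζ(k,a/q) + ζ(k,1−a/q))`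
(`Okada.sum_char_mul_hurwitz_symm`, the pairing), so `L(k, χ) = ρ π^k` would make `Σ χ(a) Z_k(a,q)` rational with the
rational coefficients `χ(a) = ±1`, hence all `χ(a)` equal (Proposition 2, `halfSystem_coeff_eq_const`) — to `χ(1) = 1`,
forcing `χ = 1`. [cite: GunRammurtyRath2011, Corollary 2 (p. 1336)] -/
theorem LFunction_ne_ratCast_mul_pi_pow {q : ℕ} [NeZero q] (χ : DirichletCharacter ℂ q) (hχ : χ ≠ 1)
    (heven : χ.Even) (hquad : MulChar.IsQuadratic χ) {k : ℕ} (hk : Even k) (hk2 : 2 ≤ k) (ρ : ℚ) :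
    χ.LFunction k ≠ (ρ : ℂ) * (Real.pi : ℂ) ^ k := by
  intro hL
  have hq := three_le_of_ne_one χ hχ
  obtain ⟨n, hn⟩ := hk
  have hn' : k = 2 * n := by omega
  -- the character sum against the symmetrised Hurwitz values
  have hsum := Okada.sum_char_mul_hurwitz_symm χ k
  have hfac : (1 + (-1 : ℂ) ^ k * χ (-1)) = 2 := by
    rw [heven, Even.neg_one_pow ⟨n, hn⟩]
    norm_num
  rw [sum_char_mul_hurwitz_symm_eq_two_mul_sum_halfSystem hq χ heven ⟨n, hn⟩, hfac, hL] at hsum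
  -- the rational coefficients `c(a) = χ(a) = ±1`
  set c : ℕ → ℚ := fun a => if χ ((a : ℕ) : ZMod q) = 1 then 1 else -1 with hc
  have hcχ : ∀ a ∈ (Finset.range q).filter (fun a => 2 * a < q ∧ a.Coprime q),
      (c a : ℂ) = χ ((a : ℕ) : ZMod q) := by
    intro a ha
    simp only [Finset.mem_filter, Finset.mem_range] at ha
    have hu : IsUnit (((a : ℕ) : ZMod q)) := (ZMod.isUnit_iff_coprime a q).mpr ha.2.2
    rcases hquad ((a : ℕ) : ZMod q) with h0 | h1 | hm1
    · exact absurd h0 (hu.map χ).ne_zero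
    · simp [hc, h1]
    · have hne : χ ((a : ℕ) : ZMod q) ≠ 1 := by rw [hm1]; norm_num
      simp only [hc, if_neg hne, hm1]
      push_cast
      rfl
  -- `π^k = (2πi)^k/((−1)^n 4^n)`
  have h2 : (2 * Real.pi * I : ℂ) ^ 2 = ((-1) * 4) * (Real.pi : ℂ) ^ 2 := by
    rw [mul_pow, mul_pow, Complex.I_sq]
    ring
  have hpow : (2 * Real.pi * I : ℂ) ^ k = (-1 : ℂ) ^ n * 4 ^ n * (Real.pi : ℂ) ^ k :=
    calc (2 * Real.pi * I : ℂ) ^ k = ((2 * Real.pi * I : ℂ) ^ 2) ^ n := by rw [hn', pow_mul]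
      _ = (((-1) * 4) * (Real.pi : ℂ) ^ 2) ^ n := by rw [h2]
      _ = (-1 : ℂ) ^ n * 4 ^ n * (Real.pi : ℂ) ^ k := by rw [mul_pow, mul_pow, ← pow_mul, ← hn']
  have hneg : ((-1 : ℂ) ^ n) ^ 2 = 1 := by rw [← pow_mul, mul_comm, pow_mul, neg_one_sq, one_pow]
  -- the relation `Σ c(a)·HS(a) = (q^k ρ (−1)^n/4^n)·(2πi)^k`
  have hrel : ∑ a ∈ (Finset.range q).filter (fun a => 2 * a < q ∧ a.Coprime q), (c a : ℂ) *
      (hurwitzZeta (ZMod.toAddCircle ((a : ℕ) : ZMod q)) k +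
        (-1 : ℂ) ^ k * hurwitzZeta (ZMod.toAddCircle (-((a : ℕ) : ZMod q))) k) =
      (((q : ℚ) ^ k * ρ * (-1) ^ n / 4 ^ n : ℚ) : ℂ) * (2 * Real.pi * I) ^ k := by
    rw [Finset.sum_congr rfl fun a ha => by rw [hcχ a ha]]
    have h2' : (2 : ℂ) ≠ 0 := two_ne_zero
    have hs : ∑ a ∈ (Finset.range q).filter (fun a => 2 * a < q ∧ a.Coprime q), χ ((a : ℕ) : ZMod q) *
        (hurwitzZeta (ZMod.toAddCircle ((a : ℕ) : ZMod q)) k +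
          (-1 : ℂ) ^ k * hurwitzZeta (ZMod.toAddCircle (-((a : ℕ) : ZMod q))) k) =
        (q : ℂ) ^ k * ((ρ : ℂ) * (Real.pi : ℂ) ^ k) := by
      apply mul_left_cancel₀ h2'
      rw [hsum]
    rw [hs, hpow]
    push_cast
    field_simp
    linear_combination (-(q : ℂ) ^ k * (ρ : ℂ)) * hneg
  obtain ⟨c₀, hc₀⟩ := halfSystem_coeff_eq_const hq ⟨n, hn⟩ hk2 c _ hrel
  -- `1` is in the half-system and `c(1) = 1`, so `χ(a) = 1` on the half-system
  have h1mem : (1 : ℕ) ∈ (Finset.range q).filter (fun a => 2 * a < q ∧ a.Coprime q) := by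
    simp only [Finset.mem_filter, Finset.mem_range]
    exact ⟨by omega, by omega, Nat.coprime_one_left q⟩
  have hc1 : c 1 = 1 := by simp [hc]
  have hχH : ∀ a ∈ (Finset.range q).filter (fun a => 2 * a < q ∧ a.Coprime q), χ ((a : ℕ) : ZMod q) = 1 := by
    intro a ha
    have hca : c a = 1 := by rw [hc₀ a ha, ← hc₀ 1 h1mem, hc1]
    by_contra hne
    have : c a = -1 := by simp [hc, hne]
    rw [this] at hca
    norm_num at hca
  -- hence `χ = 1`
  apply hχ
  refine MulChar.ext fun u => ?_
  rw [MulChar.one_apply_coe]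
  have hcop : ((u : ZMod q).val).Coprime q := ZMod.val_coe_unit_coprime u
  have hval : (((u : ZMod q).val : ℕ) : ZMod q) = (u : ZMod q) := ZMod.natCast_zmod_val _
  have hlt : (u : ZMod q).val < q := ZMod.val_lt _
  set b : ℕ := (u : ZMod q).val with hb
  rcases lt_or_ge (2 * b) q with h2b | h2b
  · rw [← hval]
    exact hχH b (by simp only [Finset.mem_filter, Finset.mem_range]; exact ⟨hlt, h2b, hcop⟩)
  · have hne : 2 * b ≠ q := by
      intro h2
      have : b ∣ q := ⟨2, by omega⟩
      have := Nat.Coprime.eq_one_of_dvd hcop this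
      omega
    have hmem : q - b ∈ (Finset.range q).filter (fun a => 2 * a < q ∧ a.Coprime q) := by
      simp only [Finset.mem_filter, Finset.mem_range]
      have hb0 : b ≠ 0 := by
        rintro h0
        rw [h0, Nat.coprime_zero_left] at hcop
        omega
      exact ⟨by omega, by omega, (Nat.coprime_self_sub_left hlt.le).2 hcop⟩
    have hcast : (((q - b : ℕ)) : ZMod q) = -(u : ZMod q) := by
      rw [Nat.cast_sub hlt.le, ZMod.natCast_self, zero_sub, hval]
    have := hχH (q - b) hmem
    rw [hcast, show -(u : ZMod q) = (-1) * (u : ZMod q) by ring, map_mul, heven, one_mul] at this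
    exact this

end Literature.NumberTheory.Irrationality.DirichletLValues

end
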